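import Literature.Analysis.Convexity.AnisotropicPerimeterSelf
import Mathlib.Analysis.Convex.Measure
import HarnessLib

/-!
# Null modifications, the whole space, and complements for the anisotropic perimeter

Topic `Literature/Analysis/Convexity`; namespace `Literature.Analysis.Convexity`. Companion of
`AnisotropicPerimeter.lean`
(`anisotropicPerimeter K A = sup {∫_A div φ : φ ∈ C¹_c, φ(x) ∈ K}`), `AnisotropicPerimeterSelf.lean`
(integration by parts `∫ Du[φ] = -∫ u div φ`) and `AnisotropicPerimeterUnion.lean`
(`P_K(A ∪ B) ≤ P_K(A) + P_K(B)`). The elementary bookkeeping rules of Maggi 2012, Exercises 1.12,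
12.9 and 12.10, for an ARBITRARY constraint body `K`:

* `anisotropicPerimeter_congr_ae` — `P_K` sees sets only up to Lebesgue-null modifications
  (`A =ᵐ B ⇒ P_K(A) = P_K(B)`; Maggi's `μ_E = μ_F ⇔ |E Δ F| = 0`), with `perimeter_congr_ae`;
* `integral_fieldDivergence_eq_zero` — `∫_{ℝⁿ} div φ = 0` for `φ ∈ C¹_c(ℝⁿ; ℝⁿ)` (Exercise 1.12
  componentwise), hence `anisotropicPerimeter_univ = 0`, and
  `setIntegral_fieldDivergence_compl`: `∫_{Aᶜ} div φ = -∫_A div φ`;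
* `anisotropicPerimeter_compl` — `P_K(ℝⁿ \ A) = P_{-K}(A)` (the outer normal flips, so the body is
  reflected); for an origin-symmetric body `P_K(ℝⁿ \ A) = P_K(A)`
  (`anisotropicPerimeter_compl_of_neg_eq`), in particular `perimeter_compl` (Maggi's (12.4)
  `P(E) = P(ℝⁿ \ E)`).

The `ae` rule is stated on a general finite-dimensional inner product space; the divergence
identities on `EuclideanSpace ℝ (Fin n)` (where the tree's integration by parts lives).
§"Convex sets" adds: a convex set agrees a.e. with its closure and with its interior (its
frontier is Lebesgue-null, Mathlib's `Convex.addHaar_frontier`), hence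
`P_K(interior A) = P_K(A) = P_K(closure A)` for convex `A` — open and closed convex polytopes /
Wulff bodies have the same `K`-perimeter (`anisotropicPerimeter_closure_eq_of_convex`,
`anisotropicPerimeter_interior_eq_of_convex`, and the `perimeter` versions).

## References
* F. Maggi, *Sets of Finite Perimeter and Geometric Variational Problems*, CUP 2012: Exercise
  1.12 p. 12 (`∫ ∇φ = 0`); Exercise 12.9 (complement, (12.4)) and Exercise 12.10 (null
  modifications), p. 123; (20.2) p. 258. [`Maggi2012`]
-/

noncomputable section

open Set Filter Function Metric
open _root_.MeasureTheory _root_.MeasureTheory.Measure ContinuousLinearMap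
open scoped ENNReal NNReal Topology Pointwise

namespace Literature.Analysis.Convexity

open Literature.MathematicalPhysics.StatisticalMechanics (fieldDivergence perimeter)

section General

variable {V : Type*} [NormedAddCommGroup V] [InnerProductSpace ℝ V] [FiniteDimensional ℝ V]
  [MeasurableSpace V] [BorelSpace V]

/-- **Null modifications do not change the `K`-perimeter:** `A =ᵐ B ⇒ P_K(A) = P_K(B)`.
[cite: Maggi2012, Exercise 12.10 p. 123 (with (20.2) p. 258)] -/
theorem anisotropicPerimeter_congr_ae (K : Set V) {A B : Set V} (h : A =ᵐ[volume] B) :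
    anisotropicPerimeter K A = anisotropicPerimeter K B := by
  unfold anisotropicPerimeter
  simp_rw [setIntegral_congr_set h]

/-- **Null modifications do not change the perimeter.** [cite: Maggi2012, Exercise 12.10 p. 123] -/
theorem perimeter_congr_ae {A B : Set V} (h : A =ᵐ[volume] B) : perimeter A = perimeter B := by
  rw [perimeter_eq_anisotropicPerimeter_closedBall, perimeter_eq_anisotropicPerimeter_closedBall,
    anisotropicPerimeter_congr_ae _ h]

omit [FiniteDimensional ℝ V] [MeasurableSpace V] [BorelSpace V] in
/-- `div (-φ) = -div φ`. [cite: Maggi2012, Exercise 12.9 p. 123 — plumbing] -/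
theorem fieldDivergence_neg (φ : V → V) (x : V) :
    fieldDivergence (-φ) x = -fieldDivergence φ x := by
  unfold fieldDivergence
  rw [fderiv_neg, ContinuousLinearMap.toLinearMap_neg, map_neg]

omit [FiniteDimensional ℝ V] [MeasurableSpace V] [BorelSpace V] in
/-- The divergence vanishes off the topological support of the field.
[cite: Maggi2012, Exercise 1.12 p. 12 — plumbing] -/
theorem fieldDivergence_eq_zero_of_notMem_tsupport {φ : V → V} {x : V} (hx : x ∉ tsupport φ) :
    fieldDivergence φ x = 0 := by
  unfold fieldDivergence
  have h : fderiv ℝ φ x = 0 := by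
    by_contra hne
    exact hx (support_fderiv_subset ℝ (Function.mem_support.2 hne))
  rw [h, ContinuousLinearMap.toLinearMap_zero, map_zero]

/-! ### Convex sets: interior, closure and the set itself have the same `K`-perimeter -/

/-- A convex set agrees with its CLOSURE up to a Lebesgue-null set (its frontier is null).
[cite: Maggi2012, Exercise 12.10 p. 123 (null modifications) — plumbing] -/
theorem closure_ae_eq_of_convex' {A : Set V} (hA : Convex ℝ A) :
    (closure A : Set V) =ᵐ[volume] A := by
  refine (ae_eq_set).2 ⟨?_, ?_⟩
  · refine measure_mono_null (fun x hx => ?_) (hA.addHaar_frontier volume)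
    exact ⟨hx.1, fun h => hx.2 (interior_subset h)⟩
  · rw [Set.sdiff_eq_empty.2 subset_closure, measure_empty]

/-- A convex set agrees with its INTERIOR up to a Lebesgue-null set.
[cite: Maggi2012, Exercise 12.10 p. 123 (null modifications) — plumbing] -/
theorem interior_ae_eq_of_convex {A : Set V} (hA : Convex ℝ A) :
    (interior A : Set V) =ᵐ[volume] A := by
  refine (ae_eq_set).2 ⟨?_, ?_⟩
  · rw [Set.sdiff_eq_empty.2 interior_subset, measure_empty]
  · refine measure_mono_null (fun x hx => ?_) (hA.addHaar_frontier volume)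
    exact ⟨subset_closure hx.1, hx.2⟩

/-- **`P_K(closure A) = P_K(A)` for convex `A`** (any body `K`).
[cite: Maggi2012, Exercise 12.10 p. 123 (with (20.2) p. 258)] -/
theorem anisotropicPerimeter_closure_eq_of_convex (K : Set V) {A : Set V} (hA : Convex ℝ A) :
    anisotropicPerimeter K (closure A) = anisotropicPerimeter K A :=
  anisotropicPerimeter_congr_ae K (closure_ae_eq_of_convex' hA)

/-- **`P_K(interior A) = P_K(A)` for convex `A`** (any body `K`): open and closed convex polytopes
(or Wulff bodies) have the same `K`-perimeter.
[cite: Maggi2012, Exercise 12.10 p. 123 (with (20.2) p. 258)] -/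
theorem anisotropicPerimeter_interior_eq_of_convex (K : Set V) {A : Set V} (hA : Convex ℝ A) :
    anisotropicPerimeter K (interior A) = anisotropicPerimeter K A :=
  anisotropicPerimeter_congr_ae K (interior_ae_eq_of_convex hA)

/-- `Per(closure A) = Per(A)` for convex `A`. [cite: Maggi2012, Exercise 12.10 p. 123] -/
theorem perimeter_closure_eq_of_convex {A : Set V} (hA : Convex ℝ A) :
    perimeter (closure A) = perimeter A :=
  perimeter_congr_ae (closure_ae_eq_of_convex' hA)

/-- `Per(interior A) = Per(A)` for convex `A`. [cite: Maggi2012, Exercise 12.10 p. 123] -/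
theorem perimeter_interior_eq_of_convex {A : Set V} (hA : Convex ℝ A) :
    perimeter (interior A) = perimeter A :=
  perimeter_congr_ae (interior_ae_eq_of_convex hA)

/-- `vol(closure A) = vol(A)` and `vol(interior A) = vol(A)` for convex `A`.
[cite: Maggi2012, Exercise 12.10 p. 123 — plumbing] -/
theorem volume_closure_eq_of_convex {A : Set V} (hA : Convex ℝ A) :
    volume (closure A) = volume A ∧ volume (interior A) = volume A :=
  ⟨measure_congr (closure_ae_eq_of_convex' hA), measure_congr (interior_ae_eq_of_convex hA)⟩

end General

/-! ### `∫ div φ = 0` and complements, on `EuclideanSpace ℝ (Fin n)` -/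

section Euclidean

variable {n : ℕ}

/-- **`∫_{ℝⁿ} div φ = 0` for `φ ∈ C¹_c(ℝⁿ; ℝⁿ)`** (Maggi's Exercise 1.12 `∫ ∇φ = 0`, componentwise).
Proof: integrate by parts against a bump `u ≡ 1` on a ball containing `spt φ` (`Du = 0` there).
[cite: Maggi2012, Exercise 1.12 p. 12] -/
theorem integral_fieldDivergence_eq_zero
    {φ : EuclideanSpace ℝ (Fin n) → EuclideanSpace ℝ (Fin n)} (hφ : ContDiff ℝ 1 φ)
    (hcφ : HasCompactSupport φ) : ∫ x, fieldDivergence φ x = 0 := by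
  -- a ball `B(0, R)` containing the support of `φ`
  obtain ⟨R, hRpos, hR⟩ : ∃ R, 0 < R ∧ tsupport φ ⊆ ball (0 : EuclideanSpace ℝ (Fin n)) R := by
    obtain ⟨r, hr⟩ := hcφ.isCompact.isBounded.subset_ball (0 : EuclideanSpace ℝ (Fin n))
    exact ⟨max r 1, by positivity, hr.trans (ball_subset_ball (le_max_left _ _))⟩
  -- a bump `u ≡ 1` on `B̄(0, R)`
  let b : ContDiffBump (0 : EuclideanSpace ℝ (Fin n)) := ⟨R, R + 1, hRpos, by linarith⟩
  set u : EuclideanSpace ℝ (Fin n) → ℝ := fun x => b x with hu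
  have huC : ContDiff ℝ 1 u := b.contDiff
  have hcu : HasCompactSupport u := b.hasCompactSupport
  have hu1 : ∀ x ∈ ball (0 : EuclideanSpace ℝ (Fin n)) R, u x = 1 := fun x hx =>
    b.one_of_mem_closedBall (ball_subset_closedBall hx)
  have hibp := integral_fderiv_apply_eq_neg_integral_mul_fieldDivergence huC hcu hφ hcφ
  -- left-hand side vanishes: `Du = 0` on the ball, `φ = 0` off it
  have hL : (fun x => fderiv ℝ u x (φ x)) = fun _ => 0 := by
    funext x
    by_cases hx : x ∈ ball (0 : EuclideanSpace ℝ (Fin n)) R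
    · have hloc : u =ᶠ[𝓝 x] fun _ => (1 : ℝ) :=
        Filter.eventuallyEq_of_mem (isOpen_ball.mem_nhds hx) fun y hy => hu1 y hy
      rw [hloc.fderiv_eq, fderiv_const_apply]; rfl
    · have hφx : φ x = 0 := image_eq_zero_of_notMem_tsupport fun h => hx (hR h)
      rw [hφx, map_zero]
  -- right-hand side: `u · div φ = div φ`
  have hRt : (fun x => u x * fieldDivergence φ x) = fieldDivergence φ := by
    funext x
    by_cases hx : x ∈ ball (0 : EuclideanSpace ℝ (Fin n)) R
    · rw [hu1 x hx, one_mul]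
    · rw [fieldDivergence_eq_zero_of_notMem_tsupport fun h => hx (hR h), mul_zero]
  rw [hL, hRt, integral_zero] at hibp
  linarith

/-- **The whole space has `K`-perimeter zero.** [cite: Maggi2012, Exercise 1.12 p. 12 (with (20.2))] -/
theorem anisotropicPerimeter_univ (K : Set (EuclideanSpace ℝ (Fin n))) :
    anisotropicPerimeter K (univ : Set (EuclideanSpace ℝ (Fin n))) = 0 := by
  refine le_antisymm (anisotropicPerimeter_le_iff.2 fun φ h₁ h₂ _ => ?_) bot_le
  rw [setIntegral_univ, integral_fieldDivergence_eq_zero h₁ h₂, ENNReal.ofReal_zero]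

/-- **`∫_{Aᶜ} div φ = -∫_A div φ`** for measurable `A` and `φ ∈ C¹_c`.
[cite: Maggi2012, Exercise 12.9 p. 123 (via Exercise 1.12)] -/
theorem setIntegral_fieldDivergence_compl {A : Set (EuclideanSpace ℝ (Fin n))}
    (hA : MeasurableSet A) {φ : EuclideanSpace ℝ (Fin n) → EuclideanSpace ℝ (Fin n)}
    (hφ : ContDiff ℝ 1 φ) (hcφ : HasCompactSupport φ) :
    ∫ x in Aᶜ, fieldDivergence φ x = -∫ x in A, fieldDivergence φ x := by
  have hfi : Integrable (fieldDivergence φ) volume :=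
    (continuous_fieldDivergence_of_contDiff hφ).integrable_of_hasCompactSupport
      (hasCompactSupport_fieldDivergence hcφ)
  have h := integral_add_compl hA hfi
  rw [integral_fieldDivergence_eq_zero hφ hcφ] at h
  linarith

/-- One inequality of the complement rule. [cite: Maggi2012, Exercise 12.9 (12.4) p. 123] -/
private theorem anisotropicPerimeter_compl_le (K : Set (EuclideanSpace ℝ (Fin n)))
    {A : Set (EuclideanSpace ℝ (Fin n))} (hA : MeasurableSet A) :
    anisotropicPerimeter K Aᶜ ≤ anisotropicPerimeter (-K) A := by
  refine anisotropicPerimeter_le_iff.2 fun φ h₁ h₂ h₃ => ?_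
  rw [setIntegral_fieldDivergence_compl hA h₁ h₂, ← integral_neg]
  have hneg : ∫ x in A, -fieldDivergence φ x = ∫ x in A, fieldDivergence (-φ) x :=
    integral_congr_ae (Eventually.of_forall fun x => (fieldDivergence_neg φ x).symm)
  rw [hneg]
  exact le_anisotropicPerimeter h₁.neg h₂.neg fun x => by
    simpa using Set.neg_mem_neg.2 (h₃ x)

/-- **Complement rule: `P_K(ℝⁿ \ A) = P_{-K}(A)`** for measurable `A` (the outer normal of the
complement is the inner normal, so the body is reflected).
[cite: Maggi2012, Exercise 12.9 (12.4) p. 123 (with (20.2) p. 258)] -/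
theorem anisotropicPerimeter_compl (K : Set (EuclideanSpace ℝ (Fin n)))
    {A : Set (EuclideanSpace ℝ (Fin n))} (hA : MeasurableSet A) :
    anisotropicPerimeter K Aᶜ = anisotropicPerimeter (-K) A := by
  refine le_antisymm (anisotropicPerimeter_compl_le K hA) ?_
  have h := anisotropicPerimeter_compl_le (-K) hA.compl
  rwa [compl_compl, neg_neg] at h

/-- **Complement rule for an origin-symmetric body:** `-K = K ⇒ P_K(ℝⁿ \ A) = P_K(A)`.
[cite: Maggi2012, Exercise 12.9 (12.4) p. 123] -/
theorem anisotropicPerimeter_compl_of_neg_eq {K : Set (EuclideanSpace ℝ (Fin n))} (hK : -K = K)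
    {A : Set (EuclideanSpace ℝ (Fin n))} (hA : MeasurableSet A) :
    anisotropicPerimeter K Aᶜ = anisotropicPerimeter K A := by
  rw [anisotropicPerimeter_compl K hA, hK]

/-- **`P(ℝⁿ \ E) = P(E)`** for De Giorgi's perimeter, measurable `E`.
[cite: Maggi2012, Exercise 12.9 (12.4) p. 123] -/
theorem perimeter_compl {A : Set (EuclideanSpace ℝ (Fin n))} (hA : MeasurableSet A) :
    perimeter Aᶜ = perimeter A := by
  rw [perimeter_eq_anisotropicPerimeter_closedBall, perimeter_eq_anisotropicPerimeter_closedBall]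
  refine anisotropicPerimeter_compl_of_neg_eq ?_ hA
  rw [neg_closedBall, neg_zero]

end Euclidean

end Literature.Analysis.Convexity

end
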